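import Summits.QuantumFields.YangMills.Theorems.HypercubicLimit.Negative.SummitTie
import Summits.QuantumFields.YangMills.Theses.CoincidenceRotationBootstrap
import HarnessLib

/-!
# `MirrorModularBoosts.HypercubicLimit` (item stmt-QuantumFields-8646) from its weak-coupling re-types (positive form)

Support file for crux stmt-QuantumFields-8646 (line `conditional-mean-telescoping`, c5 seat).  The β-free existence leg
`MirrorModularBoosts.HypercubicLimit` (the only live copy of item 8646) is implied BY NAME by each of its weak-coupling
re-types — `MirrorModularBoosts.WeakCouplingHypercubicLimit` and `CoincidenceRotationBootstrap.HypercubicLimit` (item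
stmt-QuantumFields-16154; the two decls are verbatim the same term) — by forgetting the conjunct `sch.HasWeakCouplingLimit`.
This is the positive form of `Negative/SummitTie`'s `not_weakCouplingHypercubicLimit_of_not_hypercubicLimit` (refuter,
2026-08-17): once item 16154 closes and `CoincidenceRotationBootstrap.HypercubicLimit_holds` is appended to its route file,
`hypercubicLimit_of_coincidenceRotationBootstrap HypercubicLimit_holds` closes item 8646.  Every open registered stub of the
8646 skeleton (`Cruxes/HypercubicLimit/Lines/conditional_mean_telescoping.lean`, reshape 4: (L′) `LatticeGapInput`, (WI)
`CornerFreeInfluence ∧ InfluenceReverseHolder`, (W2) `WindowRegularity`, (NG) `NonGaussianFloor`) is a physics socket shared with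
the registered skeletons of 16154 (`Lines/peel_and_disseminate.lean`: `stub_cornerFreeInfluence`, `stub_hostIRInputs`). [folklore]
-/

namespace Summit.QuantumFields.YangMills.Theorems.HypercubicLimit

open Literature.MathematicalPhysics.QuantumLattice Literature.MathematicalPhysics.AQFT
  Literature.MathematicalPhysics.QuantumFieldTheory

/-- **`WeakCouplingHypercubicLimit → HypercubicLimit`** (route MirrorModularBoosts; drop the weak-coupling conjunct of the
witness). [folklore] -/
theorem hypercubicLimit_of_weakCouplingHypercubicLimit :
    Summit.QuantumFields.YangMills.Theses.MirrorModularBoosts.WeakCouplingHypercubicLimit →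
      Summit.QuantumFields.YangMills.Theses.MirrorModularBoosts.HypercubicLimit := by
  intro h G _ _ _ _ hG
  letI : MeasurableSpace G := borel G
  haveI : BorelSpace G := ⟨rfl⟩
  obtain ⟨r, sch, S, _hweak, hrest⟩ := h G hG
  exact ⟨r, sch, S, hrest⟩

/-- **`CoincidenceRotationBootstrap.HypercubicLimit → MirrorModularBoosts.HypercubicLimit`** (item 16154 ⇒ item 8646: the
twin crux's decl is verbatim `MirrorModularBoosts.WeakCouplingHypercubicLimit`). [folklore] -/
theorem hypercubicLimit_of_coincidenceRotationBootstrap :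
    Summit.QuantumFields.YangMills.Theses.CoincidenceRotationBootstrap.HypercubicLimit →
      Summit.QuantumFields.YangMills.Theses.MirrorModularBoosts.HypercubicLimit :=
  fun h => hypercubicLimit_of_weakCouplingHypercubicLimit fun G _ _ _ _ hG => h G hG

end Summit.QuantumFields.YangMills.Theorems.HypercubicLimit
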